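import Literature.Computability.MetaComplexity.MCSPUniversalInverter
import Literature.Computability.Cryptography.OracleAdversaryFPRel
import Literature.Computability.Complexity.OracleCompositionMachine
import HarnessLib

/-!
# `MCSP` as a universal inverter: the oracle-transfer step (proofs)

Sibling proof file of `MCSPUniversalInverter.lean` (the named fact
`AllenderEtAl2006_MCSP_universalInverter : UniversalAvgInverter (Oracle.ofLanguage MCSP)`,
Allender–Buhrman–Koucký–van Melkebeek–Ronneburger 2006, Thm. 45 with §4.2). The printed route to
the `MCSP` form is: Theorem 45 for ONE language `L` of polynomial density without strings of small
`KT`-complexity, used as the oracle of the inverter `N^L`, followed by the remark (ABK⁺06 §4.2,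
p. 24 of the author version: "Other examples of such sets can be found in `P^{MCSP}`, and thus our
hardness results carry over to `MCSP` as well"; Allender–Das 2017, remark after Thm. 1: "such a
set `L` can be recognized in deterministic polynomial time with an oracle for `MCSP`") that an
oracle machine with oracle `L ∈ P^{MCSP}` is simulated by one with oracle `MCSP`. This file proves
that last step in the tree's machine model, once and for all oracles:

* `outputPMF_toOuterMeasure_le_of_run` — if adversary `N'` (oracle `B`) reproduces every HALTING
  run of adversary `N` (oracle `A`) on the same input and coins, then every event of outputs not
  containing `none` is at least as likely under `N'` as under `N`;
* `exists_simulator_of_mem_PRel` — for a PPT oracle adversary `N` and languages `A ∈ P^B` there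
  is a PPT oracle adversary `N'` with the same coin budget whose run with oracle `B` on `⟨w, r⟩`
  halts with the output of `N^A` on `⟨w, r⟩` (a missing output read as `[]`): the clocked run of
  `N` is an `FP^A` function (`OracleAdversary.clockedRun_mem_FPRel`), hence an `FP^B` function
  (`FP^A ⊆ FP^B` for `A ∈ P^B`: `OracleAlg.FPRel_subset_FPRel_of_mem_FPRel`, the composition of
  polynomial-time oracle machines, `OracleCompositionMachine.lean`);
* `oracleInvertProbAt_le_of_run`, `oracleInvertProb_le_of_run` — inversion probabilities only
  grow along such a simulation;
* `UniversalAvgInverter.of_mem_PRel` — **oracle transfer**: `A ∈ P^B` and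
  `UniversalAvgInverter (ofLanguage A)` give `UniversalAvgInverter (ofLanguage B)`;
* `mcsp_universalInverter_of_exists_PRel` — hence the named fact follows from Theorem 45 for ANY
  single language `A ∈ P^{MCSP}` (the printed reduction of the `MCSP` form to Thm. 45 proper).

What is NOT here: Theorem 45 itself for such an `A` (its printed proof is the relativised uniform
HILL theorem, ABK⁺06 Thm. 44, plus the GGM stretch and the statistical test — not in the tree).

## References

* E. Allender, H. Buhrman, M. Koucký, D. van Melkebeek, D. Ronneburger, *Power from random
  strings*, SIAM J. Comput. 35(6) (2006) 1467–1493 [AllenderEtAl2006]: Thm. 45 (p. 23 of the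
  author version) and §4.2, first paragraph (p. 24).
* E. Allender, B. Das, *Zero knowledge and circuit minimization*, Inform. and Comput. 256 (2017)
  2–8 [AllenderDas2017]: Thm. 1 and the remark following it.
* R. E. Ladner, N. A. Lynch, A. L. Selman, *A comparison of polynomial time reducibilities*,
  Theoret. Comput. Sci. 1 (1975), §2 (oracle machines compose).
-/

namespace Literature.Computability.MetaComplexity

open _root_.Computability Complexity Cryptography

/-! ### Simulating one oracle adversary by another -/

/-- **Events of halting outputs only grow along a simulation.** If `N'` has the same coin budget
as `N` and, for every input `w` and coin string `r` of the right length, every halting run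
`N^A(⟨w, r⟩) = some v` (within `N`'s round budget) is reproduced by `N'^B` (within its own round
budget), then for every set `S` of outputs with `none ∉ S` the probability that the output lies in
`S` is at least as large for `N'^B` as for `N^A` (probabilistic machines as deterministic
machines on uniformly random coins). [folklore] [cite: AroraBarak2009, Def. 7.1] -/
theorem outputPMF_toOuterMeasure_le_of_run {β : Type} {N N' : OracleAdversary β} {A B : Oracle}
    (hcoins : N'.coins = N.coins)
    (hrun : ∀ w r : List Bool, r.length = N.coins.eval w.length → ∀ v : β,
      N.alg.run A (N.fuel.eval w.length) (boolPair w r) = some v →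
        N'.alg.run B (N'.fuel.eval w.length) (boolPair w r) = some v)
    (w : List Bool) {S : Set (Option β)} (hS : none ∉ S) :
    (N.outputPMF A w).toOuterMeasure S ≤ (N'.outputPMF B w).toOuterMeasure S := by
  obtain ⟨alg', coins', fuel'⟩ := N'
  dsimp only at hcoins hrun
  subst hcoins
  rw [OracleAdversary.outputPMF_eq_map, OracleAdversary.outputPMF_eq_map,
    PMF.toOuterMeasure_map_apply, PMF.toOuterMeasure_map_apply]
  refine PMF.toOuterMeasure_mono _ fun r hr => ?_
  simp only [Set.mem_inter_iff, Set.mem_preimage] at hr ⊢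
  obtain ⟨hrS, -⟩ := hr
  cases h : N.alg.run A (N.fuel.eval w.length) (boolPair w r.toList) with
  | none => exact absurd (h ▸ hrS) hS
  | some v =>
    rw [hrun w r.toList (by simp) v h]
    exact h ▸ hrS

/-- **Simulating an adversary with oracle `A ∈ P^B` by an adversary with oracle `B`.** For a PPT
oracle adversary `N` (string outputs) and languages `A ∈ P^B` there is a PPT oracle adversary `N'`
with the same coin budget such that, for every input `w` and coins `r ∈ {0,1}^{coins |w|}`, the run
of `N'` with oracle `B` on `⟨w, r⟩` halts within its round budget and outputs
`(N^A(⟨w, r⟩)).getD []` — the output of `N` with oracle `A` within `N`'s round budget, a missing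
output read as the empty string. Construction: the clocked run of `N` is a total `FP^A` function
of `⟨w, r⟩` (`OracleAdversary.clockedRun_mem_FPRel`), `FP^A ⊆ FP^B` because polynomial-time
oracle machines compose (`OracleAlg.FPRel_subset_FPRel_of_mem_FPRel` with
`OracleAlg.ofLanguage_mem_FPRel_of_mem_PRel`), and the resulting `FP^B` machine, run for
`q(|⟨w, r⟩|) = q(2|w| + 2 + coins |w|)` rounds, is the adversary `N'`.
[cite: AllenderDas2017, remark after Thm. 1] [cite: LadnerLynchSelman1975, §2] -/
theorem exists_simulator_of_mem_PRel (N : OracleAdversary (List Bool))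
    (hN : N.IsPPT (encodingList Bool)) {A B : Language Bool}
    (hAB : A ∈ PRel (Oracle.ofLanguage B)) :
    ∃ N' : OracleAdversary (List Bool), N'.IsPPT (encodingList Bool) ∧ N'.coins = N.coins ∧
      ∀ w r : List Bool, r.length = N.coins.eval w.length →
        N'.alg.run (Oracle.ofLanguage B) (N'.fuel.eval w.length) (boolPair w r) =
          some ((N.alg.run (Oracle.ofLanguage A) (N.fuel.eval w.length) (boolPair w r)).getD []) := by
  have hg := OracleAdversary.clockedRun_mem_FPRel N hN A
  have hsub := OracleAlg.FPRel_subset_FPRel_of_mem_FPRel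
    (OracleAlg.ofLanguage_mem_FPRel_of_mem_PRel hAB) hg
  obtain ⟨C, hC, q, hCrun⟩ := hsub
  refine ⟨⟨C, N.coins, q.comp (2 * Polynomial.X + 2 + N.coins)⟩, hC, rfl, fun w r hr => ?_⟩
  have hlen : (boolPair w r).length = 2 * w.length + 2 + N.coins.eval w.length := by
    rw [length_boolPair, hr]
  have h1 := (hCrun (boolPair w r)).1
  rw [hlen] at h1
  have hfuel : (q.comp (2 * Polynomial.X + 2 + N.coins)).eval w.length =
      q.eval (2 * w.length + 2 + N.coins.eval w.length) := by
    simp [Polynomial.eval_comp]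
  dsimp only
  rw [hfuel, h1]
  simp only [boolUnpair_boolPair]

/-! ### Inversion probabilities along a simulation -/

/-- Along a simulation as in `outputPMF_toOuterMeasure_le_of_run`, the probability of inverting
`f_y` at a fixed `x` does not decrease (the success event consists of halting outputs only).
[cite: AllenderEtAl2006, Thm. 45 (the displayed probability)] -/
theorem oracleInvertProbAt_le_of_run (F : List Bool → List Bool)
    {N N' : OracleAdversary (List Bool)} {A B : Oracle} (hcoins : N'.coins = N.coins)
    (hrun : ∀ w r : List Bool, r.length = N.coins.eval w.length → ∀ v : List Bool,
      N.alg.run A (N.fuel.eval w.length) (boolPair w r) = some v →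
        N'.alg.run B (N'.fuel.eval w.length) (boolPair w r) = some v)
    (y x : List Bool) : oracleInvertProbAt F N A y x ≤ oracleInvertProbAt F N' B y x := by
  unfold oracleInvertProbAt
  set S : Set (Option (List Bool)) := {o | ∃ w, o = some w ∧ F (boolPair y w) = F (boolPair y x)}
  have hS : none ∉ S := by rintro ⟨w, hw, -⟩; cases hw
  refine ENNReal.toReal_mono ?_
    (outputPMF_toOuterMeasure_le_of_run hcoins hrun (boolPair y (F (boolPair y x))) hS)
  set μ := (N'.outputPMF B (boolPair y (F (boolPair y x)))).toOuterMeasure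
  refine ne_top_of_le_ne_top ENNReal.one_ne_top ?_
  calc μ S ≤ μ Set.univ := μ.mono (Set.subset_univ _)
    _ = 1 := (PMF.toOuterMeasure_apply_eq_one_iff _ _).2 (Set.subset_univ _)

/-- Monotonicity of the uniform average (local copy of a folklore lemma). [folklore] -/
private theorem uniformAvg_mono_local {k : ℕ} {f g : List Bool → ℝ}
    (h : ∀ x : List Bool, f x ≤ g x) : uniformAvg k f ≤ uniformAvg k g := by
  unfold uniformAvg
  exact div_le_div_of_nonneg_right (Finset.sum_le_sum fun v _ => h v.toList) (by positivity)

/-- Along a simulation, the average inversion probability `Pr_{x ← U_n, s}[…]` does not decrease.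
[cite: AllenderEtAl2006, Thm. 45 (the displayed probability)] -/
theorem oracleInvertProb_le_of_run (F : List Bool → List Bool)
    {N N' : OracleAdversary (List Bool)} {A B : Oracle} (hcoins : N'.coins = N.coins)
    (hrun : ∀ w r : List Bool, r.length = N.coins.eval w.length → ∀ v : List Bool,
      N.alg.run A (N.fuel.eval w.length) (boolPair w r) = some v →
        N'.alg.run B (N'.fuel.eval w.length) (boolPair w r) = some v)
    (y : List Bool) (n : ℕ) : oracleInvertProb F N A y n ≤ oracleInvertProb F N' B y n :=
  uniformAvg_mono_local fun x => oracleInvertProbAt_le_of_run F hcoins hrun y x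

/-! ### Oracle transfer for universal average-case inversion -/

/-- **Oracle transfer** (the step "such a set `L` can be recognized in deterministic polynomial
time with an oracle for `MCSP`" of Allender–Das 2017, remark after Thm. 1; ABK⁺06 §4.2, first
paragraph). If `A ∈ P^B` and `A` is a universal average-case inverter oracle, so is `B`: each
inverter `N^A` is replaced by its simulation `N'^B` (`exists_simulator_of_mem_PRel`), which
reproduces every halting run of `N^A` and therefore inverts with at least the same probability,
for every `n` and every parameter `y`, with the same polynomial `q`.
[cite: AllenderEtAl2006, §4.2 (p. 24, first paragraph)] [cite: AllenderDas2017, remark after Thm. 1] -/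
theorem UniversalAvgInverter.of_mem_PRel {A B : Language Bool}
    (hAB : A ∈ PRel (Oracle.ofLanguage B)) (h : UniversalAvgInverter (Oracle.ofLanguage A)) :
    UniversalAvgInverter (Oracle.ofLanguage B) := by
  intro F r hF hlen
  obtain ⟨N, q, hN, hq, hbound⟩ := h F r hF hlen
  obtain ⟨N', hN', hcoins, hsim⟩ := exists_simulator_of_mem_PRel N hN hAB
  have hrun : ∀ w s : List Bool, s.length = N.coins.eval w.length → ∀ v : List Bool,
      N.alg.run (Oracle.ofLanguage A) (N.fuel.eval w.length) (boolPair w s) = some v →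
        N'.alg.run (Oracle.ofLanguage B) (N'.fuel.eval w.length) (boolPair w s) = some v := by
    intro w s hs v hv
    rw [hsim w s hs, hv]
    rfl
  refine ⟨N', q, hN', hq, fun n y hy => (hbound n y hy).trans ?_⟩
  exact oracleInvertProb_le_of_run F hcoins hrun y n

/-- **The `MCSP` form follows from Theorem 45 for any single language in `P^{MCSP}`** (ABK⁺06
§4.2: "Other examples of such sets can be found in `P^{MCSP}`, and thus our hardness results
carry over to `MCSP` as well"): if some `A ∈ P^{MCSP}` is a universal average-case inverter
oracle — e.g. the conclusion of ABK⁺06 Thm. 45 for a dense `A ∈ P^{MCSP}` without strings of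
small `KT`-complexity — then so is `MCSP`, i.e. the named fact
`AllenderEtAl2006_MCSP_universalInverter` holds.
[cite: AllenderEtAl2006, Thm. 45 with §4.2 (p. 24)] [cite: AllenderDas2017, Thm. 1 and the remark following it] -/
theorem mcsp_universalInverter_of_exists_PRel
    (h : ∃ A : Language Bool, A ∈ PRel (Oracle.ofLanguage MCSP) ∧
      UniversalAvgInverter (Oracle.ofLanguage A)) :
    AllenderEtAl2006_MCSP_universalInverter := by
  obtain ⟨A, hA, hU⟩ := h
  exact UniversalAvgInverter.of_mem_PRel hA hU

end Literature.Computability.MetaComplexity
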